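import Summits.ResolutionOfSingularities.ResolutionOfSingularities.Theorems.PurelyInseparableDim4Target
import Literature.AlgebraicGeometry.Resolution.CentreBlowupOrdAlongBasics
import Literature.AlgebraicGeometry.Resolution.PointBlowupKangaroo
import Literature.AlgebraicGeometry.Resolution.OrdZeroBasics
import HarnessLib

/-!
# Zoo certificates ‖ K for the census cell «res-dim4-pi» — row J-003 (Z13 under MODE 1h)

[OURS · census instrument · counted 0.]  Kernel replays, against the cell's target frame
`PurelyInseparableDim4Target` (`PIDim4.Step1h`, `RiseD`, …), of rows of `boards/JUMPS.md` that the
desk has flipped to K = B (two independent engines agree).  A certificate turns a logged edge into a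
theorem about OUR model (`CentreBlowup.step`); it says nothing about resolution of singularities,
which is NOT proved in dim ≥ 4 / char p anywhere in this programme.  Brick TY-4 of `boards/WAVE2.md`
(desk GO to res-dim4-p-4, 15:45:37Z); one file, rows appended as they become K = B (D-0064).

## Row J-003 (Z13-1h; K = B: eng-A j311452 ∧ eng-B j311099; KNOWN-INSTANCE = Hauser's kangaroo
example `x² + y⁷ + yz⁴` [Hauser 2010 §§G, K] as a cylinder `× 𝔸²` inside class (4,1), `p = 2`)

Variables `(y, z, w, v) = Fin 4`.  Along the MODE-1h walk from the class root `z² + yz⁴ + y⁷`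
(plane centre `V(x; y, z)`, `y`-chart origin; divisor `V(x; y)`; plane, `z`-chart origin) the engines
reach at depth 3 the presented state `a = (F = yz³ + y³z, r = (1,1,0,0), exc = {y, z})` of shade
`d = 4 − 2 = 2` (an antelope: `F = yz·(y + z)²`).  Its MODE-1h centre is again the plane
`S = {y, z}` (`ord_{(y,z)} F = 4 ≥ 2`; no single hyperplane is `2`-fold), which also satisfies
Hauser–Perlega's condition (2) (`Σ_S r + d = 4 ≤ 4`: eclass C1, `perm2 = 1`).  At the point
`z = 1` of the `y`-chart (`b = (0,1,0,0)`): chart transform `y²z³ + y²z`, translation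
`y²(z+1)³ + y²(z+1) = y²z³ + y²z²` (char 2), cleaning deletes the square `y²z²`, both components
through the old point are lost except the new one: `k = (F' = y²z³, r' = (2,0,0,0), exc' = {y})` of
shade `5 − 2 = 3 > 2` — **RISE:d 2 → 3 on a C1 edge under MODE 1h** (J-003 letter for letter).
Since no coordinate hyperplane is permissible at `a`, the same edge is an edge of EVERY sub-rule of
the frame that picks a cardinality-minimal permissible coordinate centre (1h, and — condition (2)
holding — HP/m1/1h2): `stepHP_a_k`.  Moh's bound `d' ≤ d + p^{e−1} = 3` is attained.
-/

-- house layout `Summits/<Summit>/<Problem>` doubles the namespace component (as in the Target file)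
set_option linter.dupNamespace false

noncomputable section

namespace Summit.ResolutionOfSingularities.ResolutionOfSingularities.Theorems.PIDim4

namespace ZooCert

open MvPolynomial Finset
open Literature.AlgebraicGeometry.Resolution
open Literature.AlgebraicGeometry.Resolution.Hauser2010
open Literature.AlgebraicGeometry.Resolution.CentreBlowup

/-- The field `𝔽₂` of the certificates at `p = 2`. [folklore] -/
abbrev K2 : Type := ZMod 2

/-! ## Row J-003 -/

namespace J003

/-- exponent of `yz³`. [folklore] -/ def eP : Fin 4 →₀ ℕ := Finsupp.equivFunOnFinite.symm ![1, 3, 0, 0]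
/-- exponent of `y³z`. [folklore] -/ def eQ : Fin 4 →₀ ℕ := Finsupp.equivFunOnFinite.symm ![3, 1, 0, 0]
/-- exponent of `y²z³`. [folklore] -/ def eK : Fin 4 →₀ ℕ := Finsupp.equivFunOnFinite.symm ![2, 3, 0, 0]
/-- exponent of the deleted square `y²z²`. [folklore] -/ def eD : Fin 4 →₀ ℕ := Finsupp.equivFunOnFinite.symm ![2, 2, 0, 0]
/-- multiplicities `(1,1,0,0)` at the antelope `a`. [folklore] -/ def rA : Fin 4 →₀ ℕ := Finsupp.equivFunOnFinite.symm ![1, 1, 0, 0]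
/-- multiplicities `(2,0,0,0)` at the kangaroo `k`. [folklore] -/ def rK : Fin 4 →₀ ℕ := Finsupp.equivFunOnFinite.symm ![2, 0, 0, 0]

/-- `eP` coordinatewise. [folklore] -/ @[simp] theorem eP_apply (i : Fin 4) : eP i = ![1, 3, 0, 0] i := rfl
/-- `eQ` coordinatewise. [folklore] -/ @[simp] theorem eQ_apply (i : Fin 4) : eQ i = ![3, 1, 0, 0] i := rfl
/-- `eK` coordinatewise. [folklore] -/ @[simp] theorem eK_apply (i : Fin 4) : eK i = ![2, 3, 0, 0] i := rfl
/-- `eD` coordinatewise. [folklore] -/ @[simp] theorem eD_apply (i : Fin 4) : eD i = ![2, 2, 0, 0] i := rfl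
/-- `rA` coordinatewise. [folklore] -/ @[simp] theorem rA_apply (i : Fin 4) : rA i = ![1, 1, 0, 0] i := rfl
/-- `rK` coordinatewise. [folklore] -/ @[simp] theorem rK_apply (i : Fin 4) : rK i = ![2, 0, 0, 0] i := rfl

/-- exponents differing at one coordinate differ. [folklore] -/
private theorem ne_of_apply_ne' {d e : Fin 4 →₀ ℕ} (i : Fin 4) (h : d i ≠ e i) : d ≠ e :=
  fun hde => h (by rw [hde])

/-- the two exponents of `F` differ. [folklore] -/ theorem eP_ne_eQ : eP ≠ eQ := ne_of_apply_ne' 0 (by simp)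
/-- the two exponents of the translated transform differ. [folklore] -/ theorem eK_ne_eD : eK ≠ eD := ne_of_apply_ne' 1 (by simp)

/-- `F = yz³ + y³z` (the antelope residual, `= yz(y+z)²`). [folklore] -/
def FA : MvPolynomial (Fin 4) K2 := monomial eP 1 + monomial eQ 1
/-- `F' = y²z³` (the kangaroo residual after cleaning). [folklore] -/
def FK : MvPolynomial (Fin 4) K2 := monomial eK 1

/-- the antelope state `a = (yz³ + y³z, (1,1,0,0), {y, z})` (depth 3 of the Z13 1h walk). [folklore] -/
def a : State K2 := ⟨FA, rA, {0, 1}⟩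
/-- the kangaroo state `k = (y²z³, (2,0,0,0), {y})`. [folklore] -/
def k : State K2 := ⟨FK, rK, {0}⟩
/-- the plane centre `V(x; y, z)`, `S = {y, z}`. [folklore] -/
def S : Finset (Fin 4) := {0, 1}
/-- the point `z = 1` of the `y`-chart: translation vector `b = (0, 1, 0, 0)`. [folklore] -/
def b : Fin 4 → K2 := ![0, 1, 0, 0]

/-- `Σ_{i∈S} dᵢ = d_y + d_z`. [folklore] -/
theorem degIn_S (d : Fin 4 →₀ ℕ) : degIn S d = d 0 + d 1 := degIn_pair (by decide) d

/-- `y^a z^c` as a monomial in the four variables. [folklore] -/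
theorem X_pow_mul_X_pow (m n : ℕ) :
    (X 0 ^ m * X 1 ^ n : MvPolynomial (Fin 4) K2) = monomial (Finsupp.single 0 m + Finsupp.single 1 n) 1 := by
  simp only [X_pow_eq_monomial, monomial_mul, mul_one]
/-- `eK = 2·e_y + 3·e_z`. [folklore] -/
theorem eK_eq : eK = Finsupp.single 0 2 + Finsupp.single 1 3 := by
  ext i; fin_cases i <;> simp
/-- `eD = 2·e_y + 2·e_z`. [folklore] -/
theorem eD_eq : eD = Finsupp.single 0 2 + Finsupp.single 1 2 := by
  ext i; fin_cases i <;> simp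

/-! ### orders and the shade at `a` and at `k` -/

/-- `F ≠ 0`, `F' ≠ 0`. [folklore] -/
theorem FA_ne_zero : FA ≠ 0 := monomial_add_monomial_ne_zero eP_ne_eQ one_ne_zero one_ne_zero
/-- see `FA_ne_zero`. [folklore] -/
theorem FK_ne_zero : FK ≠ 0 := (monomial_eq_zero).not.mpr one_ne_zero

/-- total degrees. [folklore] -/
theorem degree_eP : eP.degree = 4 := by rw [Finsupp.degree_eq_sum, Fin.sum_univ_four]; simp
/-- see `degree_eP`. [folklore] -/
theorem degree_eQ : eQ.degree = 4 := by rw [Finsupp.degree_eq_sum, Fin.sum_univ_four]; simp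
/-- `ord₀ F = 4`. [folklore] -/
theorem ordZero_FA : ordZero FA = 4 := by
  rw [FA, PointBlowup.ordZero_binomial eP_ne_eQ (by rw [degree_eP, degree_eQ]), degree_eQ]; rfl
/-- `ord₀ F' = 5`. [folklore] -/
theorem ordZero_FK : ordZero FK = 5 := by
  rw [FK, ordZero_monomial _ one_ne_zero, Finsupp.degree_eq_sum, Fin.sum_univ_four]; simp

/-- shade `d = 4 − 2 = 2` at `a`. [folklore] -/
theorem shade_a : a.shade = 2 := by
  show ordZero FA - (rA.degree : ℕ∞) = 2
  rw [ordZero_FA, Finsupp.degree_eq_sum, Fin.sum_univ_four]; simp; rfl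
/-- shade `d' = 5 − 2 = 3` at `k`. [folklore] -/
theorem shade_k : k.shade = 3 := by
  show ordZero FK - (rK.degree : ℕ∞) = 3
  rw [ordZero_FK, Finsupp.degree_eq_sum, Fin.sum_univ_four]; simp; rfl

/-- `ord_{(y,z)} F = 4`. [folklore] -/
theorem ordAlong_S_FA : ordAlong S FA = (4 : ℕ) := by
  rw [FA, ordAlong_two_monomials eP_ne_eQ, degIn_S, degIn_S]; simp

/-! ### the plane `V(x; y, z)` is the MODE-1h centre at `a`, and satisfies condition (2) -/

/-- every monomial bound: permissibility at `S'` forces `2 ≤ Σ_{S'} e` for `e ∈ supp F`. [folklore] -/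
private theorem two_le_degIn {S' : Finset (Fin 4)} (h : IsPermissibleCentre 2 S' FA) {e : Fin 4 →₀ ℕ}
    (he : coeff e FA ≠ 0) : 2 ≤ degIn S' e := by
  have := le_trans h.2 (ordAlong_le_of_coeff_ne_zero (S := S') he)
  exact_mod_cast this

/-- combinatorial core: a coordinate set with `2 ≤ Σ_{S'} (1,3,0,0)` and `2 ≤ Σ_{S'} (3,1,0,0)` has at
least two elements (all 16 subsets, by `decide`). [folklore] -/
private theorem two_le_card : ∀ S' : Finset (Fin 4),
    2 ≤ ∑ i ∈ S', (![1, 3, 0, 0] : Fin 4 → ℕ) i → 2 ≤ ∑ i ∈ S', (![3, 1, 0, 0] : Fin 4 → ℕ) i →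
    2 ≤ S'.card := by
  decide

/-- `V(x; y, z)` is a MODE-1h centre at `a` (Hironaka-permissible, and no hyperplane is). [folklore] -/
theorem isMode1hCentre_a : IsMode1hCentre 2 S a.F := by
  refine ⟨⟨⟨0, by simp [S]⟩, ?_⟩, fun S' hS' => ?_⟩
  · show (2 : ℕ∞) ≤ ordAlong S FA
    rw [ordAlong_S_FA]; exact_mod_cast (by norm_num : (2 : ℕ) ≤ 4)
  · have hP := two_le_degIn hS' (e := eP)
      (by rw [FA, coeff_monomial_add_monomial, if_pos rfl, if_neg eP_ne_eQ.symm, add_zero]; exact one_ne_zero)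
    have hQ := two_le_degIn hS' (e := eQ)
      (by rw [FA, coeff_monomial_add_monomial, if_neg eP_ne_eQ, if_pos rfl, zero_add]; exact one_ne_zero)
    rw [show S.card = 2 by decide]
    simp only [degIn, eP_apply, eQ_apply] at hP hQ
    exact two_le_card S' hP hQ

/-- condition (2) of Hauser–Perlega holds for the plane at `a` (`perm2 = 1`, eclass C1):
`Σ_S r + d = 2 + 2 ≤ 4 = ord_S F`. [folklore] -/
theorem perm2_a : Perm2 S a := by
  show (degIn S rA : ℕ∞) + a.shade ≤ ordAlong S FA
  rw [shade_a, ordAlong_S_FA, degIn_S]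
  exact_mod_cast (show rA 0 + rA 1 + 2 ≤ 4 by simp)

/-! ### the edge `a ⟶ k` at the point `z = 1` of the `y`-chart -/

/-- chart law on the two exponents: `yz³ ↦ y²z³`, `y³z ↦ y²z`. [folklore] -/
theorem chartExponent_eP : chartExponent 2 S 0 eP = eK := by
  rw [chartExponent_eq_iff, degIn_S]; refine ⟨by simp, fun i hi => ?_⟩; fin_cases i <;> simp_all
/-- see `chartExponent_eP`. [folklore] -/
theorem chartExponent_eQ : chartExponent 2 S 0 eQ = Finsupp.single 0 2 + Finsupp.single 1 1 := by
  rw [chartExponent_eq_iff, degIn_S]; refine ⟨by simp, fun i hi => ?_⟩; fin_cases i <;> simp_all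

/-- **The transform at the point `z = 1` of the `y`-chart** (before cleaning):
`y²(z+1)³ + y²(z+1) = y²z³ + y²z²` in characteristic `2`. [folklore] -/
theorem pointTransform_a : pointTransform 2 S 0 b a = monomial eK 1 + monomial eD 1 := by
  have h2 : (2 : MvPolynomial (Fin 4) K2) = 0 := by
    have := CharP.cast_eq_zero (MvPolynomial (Fin 4) K2) 2
    exact_mod_cast this
  rw [pointTransform, show a.F = FA from rfl, FA, chartTransform_monomial_add_monomial, chartExponent_eP,
    chartExponent_eQ, eK_eq, eD_eq, ← X_pow_mul_X_pow, ← X_pow_mul_X_pow, ← X_pow_mul_X_pow]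
  simp only [PointBlowup.translate, map_add, map_mul, map_pow, aeval_X, b, Matrix.cons_val_zero,
    Matrix.cons_val_one, map_one, map_zero, add_zero, pow_one]
  linear_combination (X 0 ^ 2 * (X 1 ^ 2 + 2 * X 1 + 1)) * h2

/-- **Cleaning** deletes the square `y²z²` and keeps `y²z³`. [folklore] -/
theorem deletePthPowers_pointTransform_a : deletePthPowers 2 (pointTransform 2 S 0 b a) = FK := by
  have hK : ¬ IsPthPowerExponent 2 eK := fun h => by
    have := (isPthPowerExponent_iff 2 eK).mp h 1; simp at this
  have hD : IsPthPowerExponent 2 eD := (isPthPowerExponent_iff 2 eD).mpr fun i => by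
    fin_cases i <;> simp
  rw [pointTransform_a, deletePthPowers_add, deletePthPowers_monomial, deletePthPowers_monomial, if_neg hK,
    if_pos hD, add_zero, FK]

/-- the point `z = 1` of the `y`-chart is again `2`-fold (no monomial of degree `< 2`). [folklore] -/
theorem isEquimultiplePoint_a : IsEquimultiplePoint 2 S 0 b a := by
  intro d _ hd
  rw [pointTransform_a]
  have hK : eK ≠ d := fun h => by
    have h5 : eK.degree = 5 := by rw [Finsupp.degree_eq_sum, Fin.sum_univ_four]; simp
    rw [← h, h5] at hd; omega
  have hD : eD ≠ d := fun h => by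
    have h4 : eD.degree = 4 := by rw [Finsupp.degree_eq_sum, Fin.sum_univ_four]; simp
    rw [← h, h4] at hd; omega
  rw [coeff_monomial_add_monomial, if_neg hK, if_neg hD, add_zero]

/-- **New multiplicities**: `z = 0` is lost (`b_z ≠ 0`), `y = 0` becomes the new component with
`ord_S F − 2 = 2`. [folklore] -/
theorem newMult_a : newMult 2 S 0 b a = rK := by
  unfold newMult
  rw [show a.r = rA from rfl, show a.F = FA from rfl, ordAlong_S_FA, ENat.toNat_coe]
  ext i
  rw [Finsupp.update_apply, Finsupp.filter_apply]
  fin_cases i <;> simp [b]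

/-- **New exceptional set** `{y}`. [folklore] -/
theorem newExc_a : newExc 0 b a = ({0} : Finset (Fin 4)) := by
  unfold newExc
  rw [show a.exc = ({0, 1} : Finset (Fin 4)) from rfl]
  decide

/-- **The step** `a ⟶ k` of the tree's model. [folklore] -/
theorem step_a : CentreBlowup.step 2 S 0 b a = k := by
  unfold CentreBlowup.step
  rw [deletePthPowers_pointTransform_a, newMult_a, newExc_a]; rfl

/-- `a ⟶ k` is an edge above the plane centre. [folklore] -/
theorem edge_a_k : Edge 2 S a k :=
  ⟨0, b, by simp [S], rfl, isEquimultiplePoint_a, by rw [step_a]; exact FK_ne_zero, step_a.symm⟩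

/-- `a ⟶ k` is a MODE-1h step. [folklore] -/
theorem step1h_a_k : Step1h 2 a k := ⟨S, isMode1hCentre_a, edge_a_k⟩

/-- … and an HP-permissible ((1) ∧ (2)) step (eclass C1). [folklore] -/
theorem stepHP_a_k : StepHP 2 a k := ⟨S, isMode1hCentre_a.1, perm2_a, edge_a_k⟩

/-- the shade rises `2 → 3` (Moh's bound `d + p^{e−1}` attained). [folklore] -/
theorem riseD_a_k : RiseD a k := by
  show a.shade < k.shade
  rw [shade_a, shade_k]; exact_mod_cast (by norm_num : (2 : ℕ) < 3)

end J003

end ZooCert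

open ZooCert J003 in
/-- **J-003 ‖ K.**  In class (4,1) at `p = 2`, MODE 1h has a kangaroo-class RISE of the shade on a
C1 edge: the explicit Z13 states `a ⟶ k` (`yz³ + y³z ⟶ y²z³`, shade `2 → 3`), K = B by eng-A
j311452 ∧ eng-B j311099, KNOWN-INSTANCE (Hauser's kangaroo, cylinder).  Census value only; nothing
about resolution of singularities. [folklore] -/
theorem exists_step1h_riseD_two : ∃ s s' : State (ZMod 2), Step1h 2 s s' ∧ RiseD s s' :=
  ⟨a, k, step1h_a_k, riseD_a_k⟩

open ZooCert J003 in
/-- The same rise is met by the HP-permissible sub-rule ((1) ∧ (2) centres): `StepHP 2 a k`. [folklore] -/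
theorem exists_stepHP_riseD_two : ∃ s s' : State (ZMod 2), StepHP 2 s s' ∧ RiseD s s' :=
  ⟨a, k, stepHP_a_k, riseD_a_k⟩

end Summit.ResolutionOfSingularities.ResolutionOfSingularities.Theorems.PIDim4

end
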